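import Summits.ValiantsHypothesis.ValiantsHypothesis.Theorems.NewtonUnitEquationsTwoProductsPlanarCellBlockMerge

/-!
# TWO-PER-LINE: the level-count cap for cell families (val-idea-37 g4, scratch; crux `stmt-ValiantsHypothesis-5906`)

A cell family (`IsCellFamily u v R S`: every point a strict `ξ`-top of the log support for a valid weight) has AT MOST TWO points
on every line: the middle one of three collinear strict tops would have to beat both neighbours for an affine functional.
Hence for every direction `δ ≠ 0`:  `#S ≤ 2 · #{lines parallel to δ through S} ≤ 2 · #{lines parallel to δ through supp(∏(1+u) − ∏(1+v))}`.
For towers along `δ = d` on `n'` class bases with projections `A ⊂ ℤ` the last number is `≤ |Σ_m(A)|` (multiset sums of `≤ m`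
elements of `A`), e.g. `2m` for one row, `C(n'+m,m) − 1` for digit rows, `3m` for rows `{1,2,3}` — the cap that makes every few-row
census flat (ROWLUMP j320925, RELROWS j321062).  Elementary; dissociation-free; NOT a law in the ladder's currency (the number of lines
grows like `n'^m` in general); not `PlanarCellBound`, not the crux; VP ≠ VNP is NOT proved.
-/

noncomputable section

open Classical
open MvPolynomial
open Summit.ValiantsHypothesis.ValiantsHypothesis.Theorems.NewtonUnitEquations.TwoProducts.FormalLogLinearisation
open Summit.ValiantsHypothesis.ValiantsHypothesis.Theorems.NewtonUnitEquations.TwoProducts.PlanarCell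

namespace ValIdea37g4Cap

variable {m : ℕ}

/-- The invariant of the lines parallel to `δ`: `δ₁ e₀ − δ₀ e₁`. -/
def lineInv (δ : Fin 2 → ℤ) (e : Expo) : ℤ := δ 1 * ((e 0 : ℕ) : ℤ) - δ 0 * ((e 1 : ℕ) : ℤ)

/-- The position along `δ`: `δ₀ e₀ + δ₁ e₁`. -/
def posAlong (δ : Fin 2 → ℤ) (e : Expo) : ℤ := δ 0 * ((e 0 : ℕ) : ℤ) + δ 1 * ((e 1 : ℕ) : ℤ)

/-- `|δ|² ⟪ξ, e⟫ = ⟪ξ, δ⟫ · posAlong δ e − ⟪ξ, δ^⊥⟫ · lineInv δ e`: on a line parallel to `δ` the weight is affine in the position. -/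
theorem wt_decomp (δ : Fin 2 → ℤ) (ξ : Fin 2 → ℝ) (e : Expo) :
    (((δ 0 : ℤ) : ℝ) ^ 2 + ((δ 1 : ℤ) : ℝ) ^ 2) * wt ξ e =
      (ξ 0 * δ 0 + ξ 1 * δ 1) * ((posAlong δ e : ℤ) : ℝ) - (ξ 1 * δ 0 - ξ 0 * δ 1) * ((lineInv δ e : ℤ) : ℝ) := by
  simp only [wt, posAlong, lineInv]
  push_cast
  ring

/-- A point is determined by its line and its position (`δ ≠ 0`). -/
theorem eq_of_lineInv_eq_of_posAlong_eq {δ : Fin 2 → ℤ} (hδ : δ ≠ 0) {e e' : Expo}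
    (h₁ : lineInv δ e = lineInv δ e') (h₂ : posAlong δ e = posAlong δ e') : e = e' := by
  have hK : δ 0 * δ 0 + δ 1 * δ 1 ≠ 0 := by
    intro h0
    have h00 : δ 0 = 0 := by nlinarith [mul_self_nonneg (δ 0), mul_self_nonneg (δ 1)]
    have h11 : δ 1 = 0 := by nlinarith [mul_self_nonneg (δ 0), mul_self_nonneg (δ 1)]
    exact hδ (funext fun i => by fin_cases i <;> simp [h00, h11])
  simp only [lineInv, posAlong] at h₁ h₂
  have e0 : ((e 0 : ℕ) : ℤ) = ((e' 0 : ℕ) : ℤ) := by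
    have : (δ 0 * δ 0 + δ 1 * δ 1) * ((e 0 : ℕ) : ℤ) = (δ 0 * δ 0 + δ 1 * δ 1) * ((e' 0 : ℕ) : ℤ) := by
      linear_combination (δ 1) * h₁ + (δ 0) * h₂
    exact mul_left_cancel₀ hK this
  have e1 : ((e 1 : ℕ) : ℤ) = ((e' 1 : ℕ) : ℤ) := by
    have : (δ 0 * δ 0 + δ 1 * δ 1) * ((e 1 : ℕ) : ℤ) = (δ 0 * δ 0 + δ 1 * δ 1) * ((e' 1 : ℕ) : ℤ) := by
      linear_combination (-(δ 0)) * h₁ + (δ 1) * h₂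
    exact mul_left_cancel₀ hK this
  ext i
  fin_cases i
  · exact_mod_cast e0
  · exact_mod_cast e1

/-- **TWO-PER-LINE.** If every point of `S` is a strict top of one set `T` (for its own weight), then `S` has at most two points on
every line parallel to `δ ≠ 0`. -/
theorem two_per_line {T : Set Expo} {S : Finset Expo} (hS : ∀ l ∈ S, ∃ ξ : Fin 2 → ℝ, IsStrictTop ξ T l)
    (δ : Fin 2 → ℤ) (hδ : δ ≠ 0) (c : ℤ) : (S.filter fun l => lineInv δ l = c).card ≤ 2 := by
  by_contra h
  rw [not_le] at h
  obtain ⟨a, ha, b, hb, e, he, hab, hae, hbe⟩ := Finset.two_lt_card.mp h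
  simp only [Finset.mem_filter] at ha hb he
  choose ξf hξf using hS
  -- positions as reals
  set p : Expo → ℝ := fun l => ((posAlong δ l : ℤ) : ℝ) with hp
  have hK : (0 : ℝ) < ((δ 0 : ℤ) : ℝ) ^ 2 + ((δ 1 : ℤ) : ℝ) ^ 2 := by
    have : δ 0 ≠ 0 ∨ δ 1 ≠ 0 := by
      by_contra h0
      push Not at h0
      exact hδ (funext fun i => by fin_cases i <;> simp [h0.1, h0.2])
    rcases this with h0 | h0
    · have : (0 : ℝ) < ((δ 0 : ℤ) : ℝ) ^ 2 := by positivity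
      nlinarith [sq_nonneg (((δ 1 : ℤ) : ℝ))]
    · have : (0 : ℝ) < ((δ 1 : ℤ) : ℝ) ^ 2 := by positivity
      nlinarith [sq_nonneg (((δ 0 : ℤ) : ℝ))]
  -- key: for l, o on the line, both in S: A_l · (p o − p l) < 0
  have key : ∀ l (hl : l ∈ S), lineInv δ l = c → ∀ o, o ∈ S → lineInv δ o = c → o ≠ l →
      (ξf l hl 0 * δ 0 + ξf l hl 1 * δ 1) * (p o - p l) < 0 := by
    intro l hl hlc o ho hoc hol
    have htop := hξf l hl
    have hoT : o ∈ T := (hξf o ho).1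
    have hlt : wt (ξf l hl) o < wt (ξf l hl) l := htop.2 o hoT hol
    have h1 := wt_decomp δ (ξf l hl) o
    have h2 := wt_decomp δ (ξf l hl) l
    rw [hoc] at h1
    rw [hlc] at h2
    have : (((δ 0 : ℤ) : ℝ) ^ 2 + ((δ 1 : ℤ) : ℝ) ^ 2) * (wt (ξf l hl) o - wt (ξf l hl) l) < 0 :=
      mul_neg_of_pos_of_neg hK (sub_neg.mpr hlt)
    have hEq : (((δ 0 : ℤ) : ℝ) ^ 2 + ((δ 1 : ℤ) : ℝ) ^ 2) * (wt (ξf l hl) o - wt (ξf l hl) l) =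
        (ξf l hl 0 * δ 0 + ξf l hl 1 * δ 1) * (p o - p l) := by
      simp only [hp]
      linear_combination h1 - h2
    linarith [hEq ▸ this]
  -- same-sign consequence: the two other points lie on the same side of l
  have side : ∀ l (hl : l ∈ S), lineInv δ l = c → ∀ o o', o ∈ S → lineInv δ o = c → o ≠ l → o' ∈ S → lineInv δ o' = c → o' ≠ l →
      0 < (p o - p l) * (p o' - p l) := by
    intro l hl hlc o o' ho hoc hol ho' ho'c ho'l
    have k1 := key l hl hlc o ho hoc hol
    have k2 := key l hl hlc o' ho' ho'c ho'l
    rcases mul_neg_iff.mp k1 with ⟨hA, hx⟩ | ⟨hA, hx⟩ <;> rcases mul_neg_iff.mp k2 with ⟨hA', hx'⟩ | ⟨hA', hx'⟩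
    · exact mul_pos_of_neg_of_neg hx hx'
    · exact absurd hA (not_lt.mpr hA'.le)
    · exact absurd hA' (not_lt.mpr hA.le)
    · exact mul_pos hx hx'
  have sa := side a ha.1 ha.2 b e hb.1 hb.2 (Ne.symm hab) he.1 he.2 (Ne.symm hae)
  have sb := side b hb.1 hb.2 a e ha.1 ha.2 hab he.1 he.2 (Ne.symm hbe)
  have se := side e he.1 he.2 a b ha.1 ha.2 hae hb.1 hb.2 hbe
  have prod := mul_pos (mul_pos sa sb) se
  nlinarith [sq_nonneg ((p a - p b) * (p b - p e) * (p e - p a)), prod]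

/-- Corollary: `#S ≤ 2 · #(lines parallel to δ through S)`. -/
theorem card_le_two_mul_lines {T : Set Expo} {S : Finset Expo} (hS : ∀ l ∈ S, ∃ ξ : Fin 2 → ℝ, IsStrictTop ξ T l)
    (δ : Fin 2 → ℤ) (hδ : δ ≠ 0) : S.card ≤ 2 * (S.image (lineInv δ)).card :=
  Finset.card_le_mul_card_image S 2 fun c _ => two_per_line hS δ hδ c

/-- **THE CAP FOR CELL FAMILIES** (no dissociation, no tower hypothesis): a cell family has at most two points on every line. -/
theorem cellFamily_card_le_two_mul_lines (u v : Fin m → MvPolynomial (Fin 2) ℂ) (R : Expo → Expo → Prop) (S : Finset Expo)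
    (hS : IsCellFamily u v R S) (δ : Fin 2 → ℤ) (hδ : δ ≠ 0) : S.card ≤ 2 * (S.image (lineInv δ)).card :=
  card_le_two_mul_lines (T := logSupport u v) (fun l hl => by
    obtain ⟨ξ, -, htop, -⟩ := hS l hl
    exact ⟨ξ, htop⟩) δ hδ

/-- A cell family of a normalised instance lies in the support of the tail difference (log-visible = visible, `stub_logLinearisation`). -/
theorem cellFamily_subset_support_tailDiff (u v : Fin m → MvPolynomial (Fin 2) ℂ) (hu : ∀ j, coeff 0 (u j) = 0)
    (hv : ∀ j, coeff 0 (v j) = 0) (R : Expo → Expo → Prop) (S : Finset Expo) (hS : IsCellFamily u v R S) :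
    S ⊆ (tailDiff u v).support := by
  intro l hl
  obtain ⟨ξ, hξ, htop, -⟩ := hS l hl
  have h := ((stub_logLinearisation m u v hu hv ξ hξ l).mpr htop).1
  exact Finset.mem_coe.mp h

/-- **LEVEL-COUNT CAP** (typed form of memo §10.6): for every direction `δ ≠ 0`, a cell family of a normalised instance has at most
twice as many points as there are lines parallel to `δ` through `supp(∏(1+u) − ∏(1+v))`. -/
theorem cellFamily_card_le_cap (u v : Fin m → MvPolynomial (Fin 2) ℂ) (hu : ∀ j, coeff 0 (u j) = 0)
    (hv : ∀ j, coeff 0 (v j) = 0) (R : Expo → Expo → Prop) (S : Finset Expo) (hS : IsCellFamily u v R S)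
    (δ : Fin 2 → ℤ) (hδ : δ ≠ 0) : S.card ≤ 2 * ((tailDiff u v).support.image (lineInv δ)).card :=
  (cellFamily_card_le_two_mul_lines u v R S hS δ hδ).trans
    (Nat.mul_le_mul_left 2 (Finset.card_le_card
      (Finset.image_subset_image (cellFamily_subset_support_tailDiff u v hu hv R S hS))))

end ValIdea37g4Cap

end

#print axioms ValIdea37g4Cap.two_per_line
#print axioms ValIdea37g4Cap.cellFamily_card_le_cap
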